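import Literature.NumberTheory.GaloisCohomology.Howard2004.FiniteSingularTame
import HarnessLib

/-!
# Howard 2004, Def. 1.2.3 / Lemma 1.6.4: «fix a generator of `G_ℓ` for every `ℓ`, so that we may
# identify `H ⊗ G_n ≅ H`» — the identification `a ↦ a ⊗ (⊗_ℓ γ_ℓ)` is a bijection

Topic `NumberTheory/GaloisCohomology/Howard2004` (instantiation layer of Howard's Lemma 1.6.4 — the
residual Galois input of the print leaf G87 `Howard2004.thm161_dvrKolyvaginBound` = Thm. 1.6.1; cell
`pub/bsd-print-x9`, seat `bsd-line-x10b-p1-w2` g15).  THEOREMS ONLY: no definition, no named fact, no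
instance, no notation, no `sorry`.  Sequel to `FiniteSingularTame` §1 (`tmulRight_bijective`: ONE
cyclic factor) and `SelmerTriples` §G (`Gn n = ⊗_{λ ∈ n} G_λ`, `gnInsertEquiv`, `gnEmptyEquiv`).

Printed source.  B. Howard, *The Heegner point Kolyvagin system*, Compositio Math. **140** (2004)
= arXiv:1202.6340, proof of Lemma 1.6.4 (arXiv p. 11 L85–88): «fix a generator for the cyclic group
`G_ℓ` for every `ℓ ∈ 𝓛^{(2k-1)}` so that we may identify `H¹_{F(n)}(K,T^{(k)}) ⊗ G_n ≅ H¹_{F(n)}(K,T^{(k)})`»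
(`G_ℓ = k_λˣ/k_ℓˣ` cyclic of order `ℓ + 1`, Def. 1.2.1; `G_n = ⊗_{ℓ ∣ n} G_ℓ`; `(ℓ + 1) ∈ I_ℓ ⊆ I_n`
kills `T/I_nT`, hence every cohomology group of it).  The Kolyvagin classes of the tree live in
`H¹_{F(n)}(K, T/I_nT) ⊗_ℤ G_n` (`LevelData.KS`); every statement of §1.5–§1.6 about «`κ_n` as an
element of `H¹_{F(n)}`» (e.g. the hypotheses `hKS`, `hchebI/II` of `StubLemmaInductionProofs`) goes
through this identification.

* §1 `exists_forall_mem_zmultiples_gell` — a simultaneous choice of generators `γ_λ` of all `G_λ`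
  (from the tame pins of `FiniteSingularTame`).
* §2 (private `nsmul_tensor_eq_zero`: `N·A = 0 ⟹ N·(A ⊗ G) = 0`); `gnInsertEquiv_tprod` — the reindexing
  `G_{nℓ} ≅ G_n ⊗ G_ℓ` sends `⊗_{λ ∈ nℓ} γ_λ` to `(⊗_{λ ∈ n} γ_λ) ⊗ γ_ℓ`.
* §3 **`tmulRight_tprod_bijective`** — for an abelian group `A` with `#G_λ · A = 0` for every `λ ∈ n`
  and generators `γ_λ`, the map `a ↦ a ⊗ (⊗_{λ ∈ n} γ_λ) : A → A ⊗_ℤ G_n` is a BIJECTION (induction on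
  `n` along `gnInsertEquiv`, one cyclic factor at a time by `tmulRight_bijective`; `n = ∅`: `G_1 = ℤ`).
* §4 consumer forms: `exists_unique_eq_tmul_tprod` (every element of `A ⊗ G_n` is `a ⊗ γ_n` for a
  unique `a`), **`map_tmul_tprod_eq_zero_iff`** (for an additive `f : A → B` between such groups,
  `(f ⊗ 1)(a ⊗ γ_n) = 0 ↔ f a = 0` — the reading of «`loc_ℓ κ_n = 0`», «`κ_n ∈ Stub(n) ⊗ G_n`» on
  elements), `map_tmul_tprod_eq_tmul_iff`, `tmul_tprod_eq_zero_iff`.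

HONEST FRAMING.  Pure algebra of the identification; which groups are killed by the `#G_λ`
(`natCard_gell_smul_eq_zero_of_mem_level` for `T/I_nT`; its cohomology) is supplied by the consumer;
Lemma 1.6.4 / Thm. 1.6.1 / `thm161_dvrKolyvaginBound` are NOT proved; no summit statement is proved;
the Birch–Swinnerton-Dyer conjecture is not proved by any of this.

References: [Howard2004HeegnerKolyvagin] Def. 1.2.1, Def. 1.2.3, Lemma 1.6.4 proof (arXiv p. 6
L69–75, p. 7 L1–12, p. 11 L85–88); [MazurRubinMemoirs2004] Def. 1.2.2 / §4.5 (the same device).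
-/

set_option autoImplicit false

noncomputable section

open Function Field NumberField IsDedekindDomain
open scoped Classical TensorProduct NumberField

namespace Literature.NumberTheory.GaloisCohomology.Howard2004

open Literature.NumberTheory.GaloisRepresentations

variable {K : Type} [Field K] [NumberField K]

/-! ## §1 A simultaneous choice of generators of the `G_λ` -/

/-- **«fix a generator for the cyclic group `G_ℓ` for every `ℓ`»**: there is a family `γ` with `γ_λ`
generating `G_λ` for every finite place `λ` (the image of a generator of `k_λˣ`; tame pins exist).
[cite: Howard2004HeegnerKolyvagin, Lemma 1.6.4 proof (arXiv p. 11 L85–88) with Def. 1.2.1 (arXiv p. 6 L69–72)] -/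
theorem exists_forall_mem_zmultiples_gell :
    ∃ γ : ∀ v : HeightOneSpectrum (𝓞 K), Gell v,
      ∀ (v : HeightOneSpectrum (𝓞 K)) (x : Gell v), x ∈ AddSubgroup.zmultiples (γ v) :=
  ⟨fun v => (Classical.choice (nonempty_tamePin v)).gbar, fun _ x =>
    TamePin.mem_zmultiples_gbar _ x⟩

/-! ## §2 Torsion of tensor products; the reindexing on pure tensors -/

omit [NumberField K] in
/-- `N·A = 0 ⟹ N·(A ⊗_ℤ G) = 0`. [folklore] -/
private theorem nsmul_tensor_eq_zero {A G : Type} [AddCommGroup A] [AddCommGroup G] {N : ℕ}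
    (hA : ∀ a : A, N • a = 0) (x : A ⊗[ℤ] G) : N • x = 0 := by
  induction x using TensorProduct.induction_on with
  | zero => rw [smul_zero]
  | tmul a g => rw [TensorProduct.smul_tmul', hA, TensorProduct.zero_tmul]
  | add x y hx hy => rw [smul_add, hx, hy, add_zero]

omit [NumberField K] in
/-- **`G_{nℓ} ≅ G_n ⊗ G_ℓ` on the chosen generators**: `gnInsertEquiv` sends `⊗_{λ ∈ nℓ} γ_λ` to
`(⊗_{λ ∈ n} γ_λ) ⊗ γ_ℓ` (and likewise every pure tensor of a global family).
[cite: Howard2004HeegnerKolyvagin, Def. 1.2.1 (arXiv p. 6 L73–75)] -/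
theorem gnInsertEquiv_tprod (v : HeightOneSpectrum (𝓞 K)) (n : Finset (HeightOneSpectrum (𝓞 K)))
    (h : v ∉ n) (f : ∀ q : HeightOneSpectrum (𝓞 K), Gell q) :
    gnInsertEquiv v n h (PiTensorProduct.tprod ℤ fun q : ↥(insert v n) => f q) =
      (PiTensorProduct.tprod ℤ fun q : ↥n => f q) ⊗ₜ[ℤ] f v := by
  simp only [gnInsertEquiv, LinearEquiv.trans_apply, PiTensorProduct.reindex_tprod,
    PiTensorProduct.tmulEquivDep_symm_apply, TensorProduct.congr_tmul]
  exact congrArg₂ (fun (x : Gn (K := K) n) (y : Gell v) => x ⊗ₜ[ℤ] y) rfl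
    (PiTensorProduct.subsingletonEquiv_apply_tprod PUnit.unit _)

/-! ## §3 `a ↦ a ⊗ (⊗_λ γ_λ)` is a bijection `A → A ⊗ G_n` -/

omit [NumberField K] in
/-- The case `n = 1`: `A → A ⊗_ℤ G_1 = A ⊗_ℤ ℤ`, `a ↦ a ⊗ (empty tensor) = a ⊗ 1`, is a bijection.
[cite: Howard2004HeegnerKolyvagin, Def. 1.2.1 (arXiv p. 6 L74–75: «with the convention that `1 ∈ 𝓝`, `G_1 = ℤ`»)] -/
theorem tmulRight_tprod_bijective_empty {A : Type} [AddCommGroup A]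
    (f : ∀ q : HeightOneSpectrum (𝓞 K), Gell q) :
    Function.Bijective fun a : A =>
      a ⊗ₜ[ℤ] (PiTensorProduct.tprod ℤ fun q : ↥(∅ : Finset (HeightOneSpectrum (𝓞 K))) => f q :
        Gn (K := K) ∅) := by
  haveI : IsEmpty (↥(∅ : Finset (HeightOneSpectrum (𝓞 K)))) := ⟨fun x => Finset.notMem_empty _ x.2⟩
  let E : A ≃ₗ[ℤ] A ⊗[ℤ] Gn (K := K) ∅ :=
    (TensorProduct.rid ℤ A).symm.trans
      (TensorProduct.congr (LinearEquiv.refl ℤ A) (gnEmptyEquiv (K := K)).symm)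
  have h1 : gnEmptyEquiv (K := K)
      (PiTensorProduct.tprod ℤ fun q : ↥(∅ : Finset (HeightOneSpectrum (𝓞 K))) => f q) = 1 :=
    PiTensorProduct.isEmptyEquiv_apply_tprod (ι := ↥(∅ : Finset (HeightOneSpectrum (𝓞 K)))) _
  have hE : (fun a : A => a ⊗ₜ[ℤ]
      (PiTensorProduct.tprod ℤ fun q : ↥(∅ : Finset (HeightOneSpectrum (𝓞 K))) => f q :
        Gn (K := K) ∅)) = E := by
    funext a
    change _ = TensorProduct.congr (LinearEquiv.refl ℤ A) (gnEmptyEquiv (K := K)).symm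
      ((TensorProduct.rid ℤ A).symm a)
    rw [TensorProduct.rid_symm_apply, TensorProduct.congr_tmul, LinearEquiv.refl_apply,
      ← h1, LinearEquiv.symm_apply_apply]
  rw [hE]
  exact E.bijective

/-- **The identification `A ≅ A ⊗ G_n`** («fix a generator for the cyclic group `G_ℓ` for every `ℓ`
so that we may identify `H ⊗ G_n ≅ H`»): if `γ_λ` generates `G_λ` and `#G_λ · A = 0` for every
`λ ∈ n`, then `a ↦ a ⊗ (⊗_{λ ∈ n} γ_λ) : A → A ⊗_ℤ G_n` is a bijection.  Induction on `n`: along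
`G_{nℓ} ≅ G_n ⊗ G_ℓ` the map is `a ↦ (a ⊗ γ_n) ⊗ γ_ℓ`, two single-factor identifications
(`tmulRight_bijective`). [cite: Howard2004HeegnerKolyvagin, Lemma 1.6.4 proof (arXiv p. 11 L85–88)] -/
theorem tmulRight_tprod_bijective (γ : ∀ v : HeightOneSpectrum (𝓞 K), Gell v)
    (n : Finset (HeightOneSpectrum (𝓞 K)))
    (hγ : ∀ v ∈ n, ∀ x : Gell v, x ∈ AddSubgroup.zmultiples (γ v))
    {A : Type} [AddCommGroup A] (hA : ∀ v ∈ n, ∀ a : A, Nat.card (Gell v) • a = 0) :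
    Function.Bijective fun a : A =>
      a ⊗ₜ[ℤ] (PiTensorProduct.tprod ℤ fun q : ↥n => γ q : Gn (K := K) n) := by
  induction n using Finset.induction_on generalizing A with
  | empty => exact tmulRight_tprod_bijective_empty γ
  | @insert v n hv ih =>
    haveI : Finite (𝓞 K ⧸ v.asIdeal) := v.asIdeal.finiteQuotientOfFreeOfNeBot v.ne_bot
    -- the two single steps
    have h1 : Function.Bijective fun a : A =>
        a ⊗ₜ[ℤ] (PiTensorProduct.tprod ℤ fun q : ↥n => γ q : Gn (K := K) n) :=
      ih (fun w hw => hγ w (Finset.mem_insert_of_mem hw))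
        (fun w hw => hA w (Finset.mem_insert_of_mem hw))
    have h2 : Function.Bijective fun b : A ⊗[ℤ] Gn (K := K) n => b ⊗ₜ[ℤ] γ v :=
      tmulRight_bijective (γ v) (hγ v (Finset.mem_insert_self v n))
        (fun b => nsmul_tensor_eq_zero (hA v (Finset.mem_insert_self v n)) b)
    -- transport along `A ⊗ G_{nv} ≅ (A ⊗ G_n) ⊗ G_v`
    let E : A ⊗[ℤ] Gn (K := K) (insert v n) ≃ₗ[ℤ] (A ⊗[ℤ] Gn (K := K) n) ⊗[ℤ] Gell v :=
      (TensorProduct.congr (LinearEquiv.refl ℤ A) (gnInsertEquiv v n hv)).trans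
        (TensorProduct.assoc ℤ A (Gn (K := K) n) (Gell v)).symm
    have hcomp : (fun b : A ⊗[ℤ] Gn (K := K) n => b ⊗ₜ[ℤ] γ v) ∘
        (fun a : A => a ⊗ₜ[ℤ] (PiTensorProduct.tprod ℤ fun q : ↥n => γ q : Gn (K := K) n)) =
        E ∘ fun a : A =>
          a ⊗ₜ[ℤ] (PiTensorProduct.tprod ℤ fun q : ↥(insert v n) => γ q : Gn (K := K) (insert v n)) := by
      funext a
      change (a ⊗ₜ[ℤ] (PiTensorProduct.tprod ℤ fun q : ↥n => γ q)) ⊗ₜ[ℤ] γ v =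
        (TensorProduct.assoc ℤ A (Gn (K := K) n) (Gell v)).symm
          (TensorProduct.congr (LinearEquiv.refl ℤ A) (gnInsertEquiv v n hv)
            (a ⊗ₜ[ℤ] PiTensorProduct.tprod ℤ fun q : ↥(insert v n) => γ q))
      rw [TensorProduct.congr_tmul, LinearEquiv.refl_apply, gnInsertEquiv_tprod,
        TensorProduct.assoc_symm_tmul]
    have h12 := h2.comp h1
    rw [hcomp] at h12
    exact (E.bijective.of_comp_iff' _).mp h12

/-! ## §4 Consumer forms -/

/-- Every element of `A ⊗ G_n` is `a ⊗ γ_n` for a unique `a ∈ A` (`γ_n = ⊗_{λ ∈ n} γ_λ`).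
[cite: Howard2004HeegnerKolyvagin, Lemma 1.6.4 proof (arXiv p. 11 L85–88)] -/
theorem exists_unique_eq_tmul_tprod (γ : ∀ v : HeightOneSpectrum (𝓞 K), Gell v)
    (n : Finset (HeightOneSpectrum (𝓞 K)))
    (hγ : ∀ v ∈ n, ∀ x : Gell v, x ∈ AddSubgroup.zmultiples (γ v))
    {A : Type} [AddCommGroup A] (hA : ∀ v ∈ n, ∀ a : A, Nat.card (Gell v) • a = 0)
    (x : A ⊗[ℤ] Gn (K := K) n) :
    ∃! a : A, x = a ⊗ₜ[ℤ] (PiTensorProduct.tprod ℤ fun q : ↥n => γ q : Gn (K := K) n) := by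
  obtain ⟨a, ha⟩ := (tmulRight_tprod_bijective γ n hγ hA).2 x
  exact ⟨a, ha.symm, fun b hb => (tmulRight_tprod_bijective γ n hγ hA).1 (hb.symm.trans ha.symm)⟩

/-- **Reading `(f ⊗ 1)(a ⊗ γ_n) = 0` as `f a = 0`**: for an additive `f : A → B` with `#G_λ · B = 0`
(`λ ∈ n`), `(f ⊗ 1)(a ⊗ γ_n) = 0 ↔ f a = 0` — e.g. «`loc_ℓ κ_n = 0`», «the image of `κ_n` in
`H¹_s(K_ℓ, ·) ⊗ G` vanishes» read on the de-tensored class.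
[cite: Howard2004HeegnerKolyvagin, Lemma 1.6.4 proof (arXiv p. 11 L85–88; p. 12 L8–9, L23–25)] -/
theorem map_tmul_tprod_eq_zero_iff (γ : ∀ v : HeightOneSpectrum (𝓞 K), Gell v)
    (n : Finset (HeightOneSpectrum (𝓞 K)))
    (hγ : ∀ v ∈ n, ∀ x : Gell v, x ∈ AddSubgroup.zmultiples (γ v))
    {A B : Type} [AddCommGroup A] [AddCommGroup B]
    (hB : ∀ v ∈ n, ∀ b : B, Nat.card (Gell v) • b = 0) (f : A →+ B) (a : A) :
    TensorProduct.map f.toIntLinearMap LinearMap.id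
        (a ⊗ₜ[ℤ] (PiTensorProduct.tprod ℤ fun q : ↥n => γ q : Gn (K := K) n)) = 0 ↔ f a = 0 := by
  rw [TensorProduct.map_tmul, LinearMap.id_apply, AddMonoidHom.coe_toIntLinearMap]
  constructor
  · intro h
    apply (tmulRight_tprod_bijective γ n hγ hB).1
    change f a ⊗ₜ[ℤ] (PiTensorProduct.tprod ℤ fun q : ↥n => γ q : Gn (K := K) n) =
      (0 : B) ⊗ₜ[ℤ] (PiTensorProduct.tprod ℤ fun q : ↥n => γ q : Gn (K := K) n)
    rw [h, TensorProduct.zero_tmul]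
  · intro h
    rw [h, TensorProduct.zero_tmul]

/-- **Reading `(f ⊗ 1)(x) ∈ (S ⊗ G_n)`-type statements**: `(f ⊗ 1)(a ⊗ γ_n) = b ⊗ γ_n ↔ f a = b`
(`#G_λ · B = 0`), so «`κ_n ∈ Stub(n) ⊗ G_n`» reads «the de-tensored class lies in `Stub(n)`».
[cite: Howard2004HeegnerKolyvagin, Lemma 1.6.4 (arXiv p. 11 L82–88)] -/
theorem map_tmul_tprod_eq_tmul_iff (γ : ∀ v : HeightOneSpectrum (𝓞 K), Gell v)
    (n : Finset (HeightOneSpectrum (𝓞 K)))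
    (hγ : ∀ v ∈ n, ∀ x : Gell v, x ∈ AddSubgroup.zmultiples (γ v))
    {A B : Type} [AddCommGroup A] [AddCommGroup B]
    (hB : ∀ v ∈ n, ∀ b : B, Nat.card (Gell v) • b = 0) (f : A →+ B) (a : A) (b : B) :
    TensorProduct.map f.toIntLinearMap LinearMap.id
        (a ⊗ₜ[ℤ] (PiTensorProduct.tprod ℤ fun q : ↥n => γ q : Gn (K := K) n)) =
      b ⊗ₜ[ℤ] (PiTensorProduct.tprod ℤ fun q : ↥n => γ q : Gn (K := K) n) ↔ f a = b := by
  rw [TensorProduct.map_tmul, LinearMap.id_apply, AddMonoidHom.coe_toIntLinearMap]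
  exact ⟨fun h => (tmulRight_tprod_bijective γ n hγ hB).1 h, fun h => by rw [h]⟩

/-- The tensor `a ⊗ γ_n` vanishes iff `a = 0` (`#G_λ · A = 0` for `λ ∈ n`).
[cite: Howard2004HeegnerKolyvagin, Lemma 1.6.4 proof (arXiv p. 11 L85–88)] -/
theorem tmul_tprod_eq_zero_iff (γ : ∀ v : HeightOneSpectrum (𝓞 K), Gell v)
    (n : Finset (HeightOneSpectrum (𝓞 K)))
    (hγ : ∀ v ∈ n, ∀ x : Gell v, x ∈ AddSubgroup.zmultiples (γ v))
    {A : Type} [AddCommGroup A] (hA : ∀ v ∈ n, ∀ a : A, Nat.card (Gell v) • a = 0) (a : A) :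
    a ⊗ₜ[ℤ] (PiTensorProduct.tprod ℤ fun q : ↥n => γ q : Gn (K := K) n) = 0 ↔ a = 0 := by
  constructor
  · intro h
    apply (tmulRight_tprod_bijective γ n hγ hA).1
    change a ⊗ₜ[ℤ] (PiTensorProduct.tprod ℤ fun q : ↥n => γ q : Gn (K := K) n) =
      (0 : A) ⊗ₜ[ℤ] (PiTensorProduct.tprod ℤ fun q : ↥n => γ q : Gn (K := K) n)
    rw [h, TensorProduct.zero_tmul]
  · rintro rfl
    exact TensorProduct.zero_tmul _ _

end Literature.NumberTheory.GaloisCohomology.Howard2004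

end
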